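import Summits.ABC.ABC.Theses.CongruentialReceptacle
import HarnessLib

/-!
# CongruenceToEquality (route CongruentialReceptacle, item stmt-ABC-1727)

Two integers congruent modulo `m`, both of absolute value `< m/2`, are equal
("the integers are too small to wrap around"). Folklore; the proof is
`m ∣ y - x` together with `|y - x| ≤ |y| + |x| < m`.
-/

-- `Summit.<Summit>.<Problem>` is the mandated summit-side namespace (CONVENTIONS §2); for the
-- single-conjunct summit `ABC` the two coincide, so the duplicate `ABC.ABC` is deliberate.
set_option linter.dupNamespace false

namespace Summit.ABC.ABC.Theorems

/-- **Congruence to equality.** If `x ≡ y [ZMOD m]` and `2|x| < m`, `2|y| < m`, then `x = y`: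
the difference `y - x` is a multiple of `m` of absolute value `< m`, hence zero.
Closes item stmt-ABC-1727 (`CongruenceToEquality`) of route CongruentialReceptacle. -/
theorem congruenceToEquality_proof :
    Summit.ABC.ABC.Theses.CongruentialReceptacle.CongruenceToEquality := by
  unfold Summit.ABC.ABC.Theses.CongruentialReceptacle.CongruenceToEquality
  intro m x y hxy hx hy
  have hdvd : m ∣ y - x := hxy.dvd
  have habs : |y - x| < m := by
    calc |y - x| ≤ |y| + |x| := abs_sub y x
      _ < m := by
        have h0x : 0 ≤ |x| := abs_nonneg x
        have h0y : 0 ≤ |y| := abs_nonneg y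
        omega
  have h0 : y - x = 0 := Int.eq_zero_of_abs_lt_dvd hdvd habs
  omega

end Summit.ABC.ABC.Theorems
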